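import Literature.AlgebraicGeometry.AbelianSchemes.AbelianSchemeDualPair
import Literature.AlgebraicGeometry.Modules.DetClassOfIso
import Literature.AlgebraicGeometry.Modules.PullbackFrame
import HarnessLib

/-!
# The slice of a base-changed sheaf: `((1 × g)^* P)|_{X × {t₀}} ≅ P|_{X × {g t₀}}`
# (Mumford, *Abelian Varieties*, §13; Milne, *Abelian Varieties*, I §8)

Layers `Literature/AlgebraicGeometry/Motives` (§1, any `K`-schemes) and
`Literature/AlgebraicGeometry/AbelianSchemes` (§2, the bridge to the `DualPair` pull-back currency).
KERNEL ONLY: theorems; no definition, no named fact, no instance, no `sorry`.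

In the proof that the Poincaré sheaf `𝒫` on `A × Â` classifies families (Mumford §13, p. 125: «for each
`k`-valued point `α` of `S`, `L|_{A × {α}} ≅ 𝒫|_{A × {ψ(α)}}`»; Milne I §8: the pull-back `(1 × α)^*𝒫`
and its fibres) one reads the slice of a base-changed sheaf at a rational point: for `K`-schemes
`X T B`, a module `P` on `X ×_K B`, a `K`-morphism `g : T ⟶ B` and a rational point `t₀ : Spec K ⟶ T`,

  `((X × g)^* P)|_{X × {t₀}} ≅ P|_{X × {t₀ ≫ g}}`,

the slices being the pull-backs along `X ≅ X ×_K Spec K —X × t₀→ X ×_K T` (the tree's slice spelling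
`((ρ_ X).inv ≫ X ◁ t₀).left`, as in ★ `Motives/SeesawTrivialLocusRationalPoint`,
★ `Motives/SeesawTrivialOnRationalSlices`, ★ `Motives/SeesawTheorem`).  This is Mathlib's
`Scheme.Modules.pullbackComp` along `((ρ_ X)⁻¹ ≫ X ◁ t₀) ≫ X ◁ g = (ρ_ X)⁻¹ ≫ X ◁ (t₀ ≫ g)`
(`MonoidalCategory.whiskerLeft_comp`):

* §1 `rightUnitor_inv_whiskerLeft_comp_whiskerLeft`, `slice_left_comp_whiskerLeft_left` (the morphism
  identity in `SchemeOver K` and on underlying schemes), **`nonempty_pullback_slice_pullback_whiskerLeft_iso`**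
  (the isomorphism of modules), **`detClass_pullback_slice_pullback_whiskerLeft`** (its reading on
  determinant classes in `Ȟ¹(X, 𝒪_X^×)`, for ANY local-freeness witnesses, ★ `detClass_eq_of_iso`) and
  `hasRank_pullback_slice_pullback_whiskerLeft_iff` (rank bookkeeping);
* §2 **`AbelianSchemeOver.baseChangeToProd_eq_whiskerLeft_left`** — the `DualPair` pull-back map
  `1_A × g : A_T → A ×_S B` of ★ `AbelianSchemes/AbelianSchemeDualPair` (`baseChangeToProd A B T.hom g.left _`,
  a `pullback.lift`) IS the cartesian-monoidal whiskering `(A.X ◁ g).left` of `Over S`, and its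
  specialisation `baseChangeToProd_ofAbelianVariety_eq_whiskerLeft_left` to abelian varieties over a
  field (the spelling of the (R3a) head of cell `hodgecm-mathlib`), so that §1 rewrites into the
  `DualPair.classify` currency.

## References
* [MumfordAV1970] D. Mumford, *Abelian Varieties* (1970), §13, p. 125 (the family `(1 × ψ)^*𝒫` and its
  restrictions to `A × {α}`); §10, p. 89.
* [MilneAV2008] J. S. Milne, *Abelian Varieties* (2008), I §8, pp. 36–37 (`(1 × α)^*𝒫`, `𝒫|_{A × {b}}`).
-/

noncomputable section

universe u

open CategoryTheory CategoryTheory.Limits AlgebraicGeometry MonoidalCategory CartesianMonoidalCategory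

/-! ### §1 Slices of base-changed modules over `K`-schemes -/

namespace Literature.AlgebraicGeometry.Motives

open Literature.AlgebraicGeometry.Modules

variable {K : Type u} [Field K] (X : SchemeOver K) {T B : SchemeOver K}

/-- **Slicing after base change is slicing at the image point**, as `K`-morphisms:
`(X ≅ X × Spec K —X × t₀→ X × T) ≫ (X × g) = X ≅ X × Spec K —X × (t₀ ≫ g)→ X × B`
(`MonoidalCategory.whiskerLeft_comp`). [cite: MilneAV2008, I §8 (pp. 36–37)] -/
@[reassoc]
theorem rightUnitor_inv_whiskerLeft_comp_whiskerLeft (t₀ : 𝟙_ (SchemeOver K) ⟶ T) (g : T ⟶ B) :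
    ((ρ_ X).inv ≫ X ◁ t₀) ≫ X ◁ g = (ρ_ X).inv ≫ X ◁ (t₀ ≫ g) := by
  rw [Category.assoc, MonoidalCategory.whiskerLeft_comp]

/-- The same identity on underlying schemes (`Over.comp_left`). [cite: MilneAV2008, I §8 (pp. 36–37)] -/
@[reassoc]
theorem slice_left_comp_whiskerLeft_left (t₀ : 𝟙_ (SchemeOver K) ⟶ T) (g : T ⟶ B) :
    ((ρ_ X).inv ≫ X ◁ t₀).left ≫ (X ◁ g).left = ((ρ_ X).inv ≫ X ◁ (t₀ ≫ g)).left := by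
  rw [← Over.comp_left, rightUnitor_inv_whiskerLeft_comp_whiskerLeft]

/-- **The slice of a base-changed sheaf** (Mumford §13, p. 125; Milne I §8): for a module `P` on
`X ×_K B`, a `K`-morphism `g : T ⟶ B` and a rational point `t₀` of `T`,
`((X × g)^* P)|_{X × {t₀}} ≅ P|_{X × {t₀ ≫ g}}` — Mathlib `Scheme.Modules.pullbackComp` and
`pullbackCongr` along `slice_left_comp_whiskerLeft_left`. [cite: MumfordAV1970, §13 (p. 125)]
[cite: MilneAV2008, I §8 (pp. 36–37)] -/
theorem nonempty_pullback_slice_pullback_whiskerLeft_iso (P : (X ⊗ B).left.Modules) (g : T ⟶ B)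
    (t₀ : 𝟙_ (SchemeOver K) ⟶ T) :
    Nonempty ((Scheme.Modules.pullback ((ρ_ X).inv ≫ X ◁ t₀).left).obj
        ((Scheme.Modules.pullback (X ◁ g).left).obj P) ≅
      (Scheme.Modules.pullback ((ρ_ X).inv ≫ X ◁ (t₀ ≫ g)).left).obj P) :=
  ⟨(Scheme.Modules.pullbackComp ((ρ_ X).inv ≫ X ◁ t₀).left (X ◁ g).left).app P ≪≫
    (Scheme.Modules.pullbackCongr (slice_left_comp_whiskerLeft_left X t₀ g)).app P⟩

/-- **Determinant classes of slices of a base-changed sheaf**: for a finite locally free `P` on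
`X ×_K B`, `[det ((X × g)^* P)|_{X × {t₀}}] = [det P|_{X × {t₀ ≫ g}}]` in `Ȟ¹(X, 𝒪_X^×)`, for ANY
witnesses of local freeness (★ `detClass_eq_of_iso` along
`nonempty_pullback_slice_pullback_whiskerLeft_iso`; in rank one this is the statement
«`((1 × g)^*𝒫)_{t₀} ≅ 𝒫_{g t₀}`» read in `Pic X`, ★ `nonempty_iso_iff_detClass_eq`).
[cite: MumfordAV1970, §13 (p. 125)] [cite: MilneAV2008, I §8 (pp. 36–37)] -/
theorem detClass_pullback_slice_pullback_whiskerLeft (P : (X ⊗ B).left.Modules) (g : T ⟶ B)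
    (t₀ : 𝟙_ (SchemeOver K) ⟶ T)
    (h₁ : IsFiniteLocallyFree ((Scheme.Modules.pullback ((ρ_ X).inv ≫ X ◁ t₀).left).obj
        ((Scheme.Modules.pullback (X ◁ g).left).obj P)))
    (h₂ : IsFiniteLocallyFree ((Scheme.Modules.pullback ((ρ_ X).inv ≫ X ◁ (t₀ ≫ g)).left).obj P)) :
    detClass h₁ = detClass h₂ := by
  obtain ⟨φ⟩ := nonempty_pullback_slice_pullback_whiskerLeft_iso X P g t₀
  exact detClass_eq_of_iso φ h₁ h₂

/-- The same with the canonical witnesses `hP.pullback _ |>.pullback _` and `hP.pullback _` of a finite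
locally free `P` (the shape produced by ★ `IsFiniteLocallyFree.pullback`). [cite: MumfordAV1970, §13 (p. 125)]
[cite: MilneAV2008, I §8 (pp. 36–37)] -/
theorem detClass_pullback_pullback_slice_eq (P : (X ⊗ B).left.Modules) (hP : IsFiniteLocallyFree P)
    (g : T ⟶ B) (t₀ : 𝟙_ (SchemeOver K) ⟶ T) :
    detClass ((hP.pullback (X ◁ g).left).pullback ((ρ_ X).inv ≫ X ◁ t₀).left) =
      detClass (hP.pullback ((ρ_ X).inv ≫ X ◁ (t₀ ≫ g)).left) :=
  detClass_pullback_slice_pullback_whiskerLeft X P g t₀ _ _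

/-- Rank bookkeeping for the slice of a base-changed sheaf: `((X × g)^* P)|_{X × {t₀}}` has rank `r` iff
`P|_{X × {t₀ ≫ g}}` has (★ `hasRank_of_iso`). [cite: MilneAV2008, I §8 (pp. 36–37)] -/
theorem hasRank_pullback_slice_pullback_whiskerLeft_iff (P : (X ⊗ B).left.Modules) (g : T ⟶ B)
    (t₀ : 𝟙_ (SchemeOver K) ⟶ T) (r : ℕ) :
    HasRank ((Scheme.Modules.pullback ((ρ_ X).inv ≫ X ◁ t₀).left).obj
        ((Scheme.Modules.pullback (X ◁ g).left).obj P)) r ↔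
      HasRank ((Scheme.Modules.pullback ((ρ_ X).inv ≫ X ◁ (t₀ ≫ g)).left).obj P) r := by
  obtain ⟨φ⟩ := nonempty_pullback_slice_pullback_whiskerLeft_iso X P g t₀
  exact ⟨hasRank_of_iso φ, hasRank_of_iso φ.symm⟩

end Literature.AlgebraicGeometry.Motives

/-! ### §2 The `DualPair` base-change map `1_A × g` is the whiskering `A ◁ g` -/

namespace Literature.AlgebraicGeometry.AbelianSchemes

namespace AbelianSchemeOver

open Literature.AlgebraicGeometry.Motives

variable {S : Scheme.{u}} (A B : AbelianSchemeOver S)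

/-- **`1_A × g = A ◁ g`**: for abelian schemes `A`, `B` over `S` and an `S`-morphism `g : T ⟶ B` from
`T ∈ Over S`, the `DualPair` base-change map `baseChangeToProd A B T.hom g.left _ : A ×_S T → A ×_S B`
of ★ `AbelianSchemes/AbelianSchemeDualPair` (a `pullback.lift` of `pr_A` and `pr_T ≫ g`) is the underlying
scheme morphism of the cartesian-monoidal whiskering `A.X ◁ g` of `Over S` (both have the projections
`pr_A` and `pr_T ≫ g`; `pullback.hom_ext`). [cite: MilneAV2008, I §8 (pp. 36–37)] -/
theorem baseChangeToProd_eq_whiskerLeft_left {T : Over S} (g : T ⟶ B.X) :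
    A.baseChangeToProd B T.hom g.left (Over.w g) = (A.X ◁ g).left := by
  apply pullback.hom_ext
  · rw [baseChangeToProd_fst]
    exact (Over.whiskerLeft_left_fst (R := A.X) g).symm
  · rw [baseChangeToProd_snd]
    exact (Over.whiskerLeft_left_snd (R := A.X) g).symm

/-- **`1_A × ψ = A ◁ ψ` for abelian varieties over a field** (the spelling of the (R3a) head: the abelian
schemes `ofAbelianVariety A`, `ofAbelianVariety B` over `Spec K` of two abelian varieties `A`, `B`, a
`K`-scheme `T` and `ψ : T ⟶ B.X` over `K`). [cite: MilneAV2008, I §8 (pp. 36–37)]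
[cite: MumfordAV1970, §13 (p. 125)] -/
theorem baseChangeToProd_ofAbelianVariety_eq_whiskerLeft_left {K : Type u} [Field K]
    (A B : AbelianVariety K) {T : SchemeOver K} (ψ : T ⟶ B.X) :
    (ofAbelianVariety A).baseChangeToProd (ofAbelianVariety B) T.hom ψ.left (Over.w ψ) =
      (A.X ◁ ψ).left :=
  baseChangeToProd_eq_whiskerLeft_left (ofAbelianVariety A) (ofAbelianVariety B) ψ

end AbelianSchemeOver

end Literature.AlgebraicGeometry.AbelianSchemes

end
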